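import Literature.NumberTheory.BeurlingPrimes.IntegerContinuation
import Mathlib.Analysis.SpecialFunctions.Complex.LogBounds
import HarnessLib

/-!
# `ζ_P(1 + it) ≠ 0`: discharge of `MontgomeryVaughan2007_eq_8_49`

Topic `Literature/NumberTheory/BeurlingPrimes`. Everything in this file is PROVED; it DISCHARGES the
named fact `Literature.NumberTheory.BeurlingPrimes.MontgomeryVaughan2007_eq_8_49` of
`WellBehavedIntegers.lean` (`MontgomeryVaughan2007_eq_8_49_holds`): for a Beurling system with
`|N_P(x) − ρx| ≤ Cx^β` (`ρ > 0`, `β < 1`), every analytic continuation `Z` of `ζ_P` to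
`{Re s > β} ∖ {1}` satisfies `Z(1 + it) ≠ 0` for real `t ≠ 0`.

Montgomery–Vaughan 2007, §8.4, proof of Thm. 8.10 ((8.49)–(8.50)): "By mimicking the proof of the
usual Euler product formula … `ζ_P(s) ≠ 0` for `σ > 1`, and indeed we may write
`log ζ_P(s) = Σ_p Σ_r r⁻¹ p^{−rs}` (8.50)", followed by the Mertens-type inequality. MV need a Fejér
kernel because under their weak hypothesis (8.46) only `ζ_P(σ+it) − ζ_P(1+it) ≪ (σ−1)^{1/2+η}` is
available; under `N_P(x) = ρx + O(x^β)` the continuation is holomorphic at `1 + it`, so the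
classical `3 + 4cos θ + cos 2θ ≥ 0` argument (their Chapter 6) suffices, and that is what is
formalised here:

* `re_neg_log_comb_nonneg` — `3 Re(−log(1−a)) + 4 Re(−log(1−az)) + Re(−log(1−az²)) ≥ 0` for
  `0 ≤ a < 1`, `|z| = 1` (power series of `−log(1 − w)` and `3 + 4cos + cos 2 = 2(1 + cos)²`);
* `one_le_norm_zeta_three_four_one` — `|ζ_P(σ)|³ |ζ_P(σ+it)|⁴ |ζ_P(σ+2it)| ≥ 1` for `σ > 1`
  (Euler product `ζ_P = exp Σ_j −log(1 − λ_j^{−s})`, tree `BeurlingPrimes.zeta_eq_exp_tsum`);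
* `MontgomeryVaughan2007_eq_8_49_holds` — if `Z(1+it) = 0` then, as `σ → 1⁺`,
  `|ζ_P(σ)| ≤ C₀/(σ−1)` (the pole, from `intZeta`), `|ζ_P(σ+it)| ≤ K(σ−1)` (differentiability of
  `Z` at `1+it`), `|ζ_P(σ+2it)| ≤ M` (continuity at `1+2it`), so the product is `≤ C₀³K⁴M(σ−1) → 0`,
  a contradiction.

## References
* [MontgomeryVaughan2007] H. L. Montgomery, R. C. Vaughan, *Multiplicative Number Theory I*, CUP 2007,
  §8.4, proof of Thm. 8.10, (8.49)–(8.50); §6.1 (the `3–4–1` inequality) (read).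
-/

noncomputable section

open Set Filter Complex Topology Asymptotics

namespace Literature.NumberTheory.BeurlingPrimes

open Literature.Barriers.RiemannHypothesis

/-! ### The `3–4–1` positivity -/

/-- `3 + 4 Re u + Re u² = 2(1 + Re u)² ≥ 0` for `|u| = 1`. [cite: MontgomeryVaughan2007, §6.1] -/
theorem three_add_four_mul_re_add_re_sq_nonneg {u : ℂ} (hu : ‖u‖ = 1) :
    0 ≤ 3 + 4 * u.re + (u ^ 2).re := by
  have h1 : u.re * u.re + u.im * u.im = 1 := by
    have h := Complex.normSq_eq_norm_sq u
    rw [hu, one_pow, Complex.normSq_apply] at h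
    linarith
  have h2 : (u ^ 2).re = u.re * u.re - u.im * u.im := by rw [sq, Complex.mul_re]
  rw [h2]
  nlinarith [sq_nonneg (1 + u.re)]

/-- **Mertens' positivity**: for `0 ≤ a < 1` and `|z| = 1`,
`3 Re(−log(1−a)) + 4 Re(−log(1−az)) + Re(−log(1−az²)) = Σ_n (aⁿ/n)(3 + 4Re zⁿ + Re z^{2n}) ≥ 0`.
[cite: MontgomeryVaughan2007, §6.1] -/
theorem re_neg_log_comb_nonneg {a : ℝ} (ha0 : 0 ≤ a) (ha1 : a < 1) {z : ℂ} (hz : ‖z‖ = 1) :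
    0 ≤ 3 * (-Complex.log (1 - a)).re + 4 * (-Complex.log (1 - a * z)).re +
      (-Complex.log (1 - a * z ^ 2)).re := by
  have hn1 : ‖(a : ℂ)‖ < 1 := by rw [Complex.norm_real, Real.norm_of_nonneg ha0]; exact ha1
  have hn2 : ‖(a : ℂ) * z‖ < 1 := by rw [norm_mul, hz, mul_one]; exact hn1
  have hn3 : ‖(a : ℂ) * z ^ 2‖ < 1 := by rw [norm_mul, norm_pow, hz, one_pow, mul_one]; exact hn1
  have h1 := (Complex.hasSum_taylorSeries_neg_log hn1).mapL Complex.reCLM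
  have h2 := (Complex.hasSum_taylorSeries_neg_log hn2).mapL Complex.reCLM
  have h3 := (Complex.hasSum_taylorSeries_neg_log hn3).mapL Complex.reCLM
  simp only [Complex.reCLM_apply] at h1 h2 h3
  have h := ((h1.mul_left 3).add (h2.mul_left 4)).add h3
  refine h.nonneg fun n ↦ ?_
  have hzn : ‖z ^ n‖ = 1 := by rw [norm_pow, hz, one_pow]
  have q1 : ((a : ℂ) ^ n / n).re = a ^ n / n := by
    rw [← Complex.ofReal_pow, ← Complex.ofReal_natCast, ← Complex.ofReal_div, Complex.ofReal_re]
  have q2 : (((a : ℂ) * z) ^ n / n).re = a ^ n / n * (z ^ n).re := by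
    have : ((a : ℂ) * z) ^ n / n = ((a ^ n / n : ℝ) : ℂ) * z ^ n := by push_cast; ring
    rw [this, Complex.re_ofReal_mul]
  have q3 : (((a : ℂ) * z ^ 2) ^ n / n).re = a ^ n / n * ((z ^ n) ^ 2).re := by
    have : ((a : ℂ) * z ^ 2) ^ n / n = ((a ^ n / n : ℝ) : ℂ) * (z ^ n) ^ 2 := by push_cast; ring
    rw [this, Complex.re_ofReal_mul]
  rw [q1, q2, q3]
  have han : 0 ≤ a ^ n / n := div_nonneg (pow_nonneg ha0 n) (Nat.cast_nonneg n)
  have key := mul_nonneg han (three_add_four_mul_re_add_re_sq_nonneg hzn)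
  linarith

/-- `log((1−w)⁻¹) = −log(1−w)` for `|w| < 1` (then `Re(1−w) > 0`, so `arg(1−w) ≠ π`). [folklore] -/
theorem log_inv_one_sub {w : ℂ} (hw : ‖w‖ < 1) :
    Complex.log (1 - w)⁻¹ = -Complex.log (1 - w) := by
  rw [Complex.log_inv]
  intro harg
  have hre : 0 < (1 - w).re := by
    have := (abs_re_le_norm w).trans_lt hw
    rw [sub_re, one_re]
    linarith [(abs_lt.mp this).2]
  have := Complex.arg_eq_pi_iff.mp harg
  linarith [this.1]

/-! ### `|ζ_P(σ)|³ |ζ_P(σ+it)|⁴ |ζ_P(σ+2it)| ≥ 1` -/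

/-- **`|ζ_P(σ)|³ |ζ_P(σ+it)|⁴ |ζ_P(σ+2it)| ≥ 1`** for `σ > 1` (given `Σ_j λ_j^{−σ} < ∞`) and real `t`:
from `ζ_P(s) = exp(Σ_j −log(1 − λ_j^{−s}))` (tree, `zeta_eq_exp_tsum`) and Mertens' positivity with
`a = λ_j^{−σ}`, `z = λ_j^{−it}`. [cite: MontgomeryVaughan2007, §8.4, proof of Thm 8.10 ((8.50) and the display after it)] -/
theorem one_le_norm_zeta_three_four_one (P : BeurlingPrimes) {σ : ℝ} (hσ : 1 < σ)
    (hsum : Summable fun j ↦ P.prime j ^ (-σ)) (t : ℝ) :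
    1 ≤ ‖P.zeta σ‖ ^ 3 * ‖P.zeta (σ + t * I)‖ ^ 4 * ‖P.zeta (σ + 2 * t * I)‖ := by
  set L : ℂ → ℕ → ℂ := fun s j ↦ Complex.log ((1 - ((P.prime j : ℝ) : ℂ) ^ (-s))⁻¹) with hL
  have hre : ∀ s : ℂ, s.re = σ → 0 < s.re ∧ Summable fun j ↦ P.prime j ^ (-s.re) :=
    fun s hs ↦ ⟨by rw [hs]; linarith, by rw [hs]; exact hsum⟩
  have hnorm : ∀ s : ℂ, s.re = σ → ‖P.zeta s‖ = Real.exp (∑' j, (L s j).re) := by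
    intro s hs
    obtain ⟨h0, hs'⟩ := hre s hs
    rw [P.zeta_eq_exp_tsum h0 hs', Complex.norm_exp, Complex.re_tsum (P.summable_log_eulerFactor h0 hs')]
  have hsumre : ∀ s : ℂ, s.re = σ → Summable fun j ↦ (L s j).re := by
    intro s hs
    obtain ⟨h0, hs'⟩ := hre s hs
    have := (P.summable_log_eulerFactor h0 hs').mapL Complex.reCLM
    simpa only [Complex.reCLM_apply] using this
  -- the three points
  have h0re : ((σ : ℂ)).re = σ := by simp
  have h1re : ((σ : ℂ) + t * I).re = σ := by simp
  have h2re : ((σ : ℂ) + 2 * t * I).re = σ := by simp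
  have e3 : ∀ x : ℝ, Real.exp x ^ 3 = Real.exp (3 * x) := fun x ↦ by
    rw [← Real.exp_nat_mul]; norm_num
  have e4 : ∀ x : ℝ, Real.exp x ^ 4 = Real.exp (4 * x) := fun x ↦ by
    rw [← Real.exp_nat_mul]; norm_num
  rw [hnorm _ h0re, hnorm _ h1re, hnorm _ h2re, e3, e4, ← Real.exp_add, ← Real.exp_add]
  refine Real.one_le_exp ?_
  rw [← tsum_mul_left, ← tsum_mul_left, ← ((hsumre _ h0re).mul_left 3).tsum_add ((hsumre _ h1re).mul_left 4),
    ← (((hsumre _ h0re).mul_left 3).add ((hsumre _ h1re).mul_left 4)).tsum_add (hsumre _ h2re)]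
  refine tsum_nonneg fun j ↦ ?_
  -- termwise: `a = λ_j^{−σ}`, `z = λ_j^{−it}`
  have hp := P.prime_pos j
  have hp0 : ((P.prime j : ℝ) : ℂ) ≠ 0 := ofReal_ne_zero.mpr hp.ne'
  set a : ℝ := P.prime j ^ (-σ) with ha
  set z : ℂ := ((P.prime j : ℝ) : ℂ) ^ (-(t * I)) with hzdef
  have ha0 : 0 ≤ a := Real.rpow_nonneg hp.le _
  have ha1 : a < 1 := Real.rpow_lt_one_of_one_lt_of_neg (P.one_lt_prime j) (by linarith)
  have hz : ‖z‖ = 1 := by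
    rw [hzdef, norm_cpow_eq_rpow_re_of_pos hp]
    simp
  have hw1 : ((P.prime j : ℝ) : ℂ) ^ (-(σ : ℂ)) = (a : ℂ) := by
    rw [ha, Complex.ofReal_cpow hp.le]
    push_cast
    rfl
  have hw2 : ((P.prime j : ℝ) : ℂ) ^ (-((σ : ℂ) + t * I)) = (a : ℂ) * z := by
    rw [neg_add, Complex.cpow_add _ _ hp0, hw1]
  have hw3 : ((P.prime j : ℝ) : ℂ) ^ (-((σ : ℂ) + 2 * t * I)) = (a : ℂ) * z ^ 2 := by
    have : -((σ : ℂ) + 2 * t * I) = -(σ : ℂ) + ((2 : ℕ) : ℂ) * (-(t * I)) := by push_cast; ring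
    rw [this, Complex.cpow_add _ _ hp0, hw1, Complex.cpow_nat_mul]
  have hnorm_lt : ∀ w : ℂ, w = (a : ℂ) ∨ w = (a : ℂ) * z ∨ w = (a : ℂ) * z ^ 2 → ‖w‖ < 1 := by
    have hna : ‖(a : ℂ)‖ < 1 := by rw [Complex.norm_real, Real.norm_of_nonneg ha0]; exact ha1
    rintro w (rfl | rfl | rfl)
    · exact hna
    · rw [norm_mul, hz, mul_one]; exact hna
    · rw [norm_mul, norm_pow, hz, one_pow, mul_one]; exact hna
  simp only [hL]
  rw [hw1, hw2, hw3, log_inv_one_sub (hnorm_lt _ (Or.inl rfl)),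
    log_inv_one_sub (hnorm_lt _ (Or.inr (Or.inl rfl))),
    log_inv_one_sub (hnorm_lt _ (Or.inr (Or.inr rfl)))]
  exact re_neg_log_comb_nonneg ha0 ha1 hz

/-! ### The limit `σ → 1⁺` -/

/-- On the real axis near the pole: `‖ζ_P(σ)‖ ≤ (2ρ + 2C/(1−β))/(σ − 1)` for `1 < σ ≤ 2`, from
`ζ_P(σ) = ρσ/(σ−1) + σI(σ)`, `‖I(σ)‖ ≤ C/(σ − β)`. [cite: MontgomeryVaughan2007, §8.4, proof of Thm 8.10] -/
theorem norm_zeta_real_le {P : BeurlingPrimes} {ρ C β : ℝ} (hρ : 0 ≤ ρ) (hβ : β < 1)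
    (hN : ∀ x : ℝ, 1 ≤ x → |(P.intCount x : ℝ) - ρ * x| ≤ C * x ^ β) {σ : ℝ} (h1 : 1 < σ)
    (h2 : σ ≤ 2) : ‖P.zeta σ‖ ≤ (2 * ρ + 2 * (C / (1 - β))) / (σ - 1) := by
  have hC : 0 ≤ C := Hilberdink.const_nonneg hN
  have hs : (1 : ℝ) < ((σ : ℂ)).re := by simpa using h1
  rw [← intZeta_eq_zeta hβ hN hs, BeurlingPrimes.intZeta]
  have hI : ‖mellin (Hilberdink.errN P ρ) (-(σ : ℂ))‖ ≤ C / (((σ : ℂ)).re - β) :=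
    Hilberdink.norm_mellin_errN_le hN (by simp; linarith)
  simp only [Complex.ofReal_re] at hI
  have h1β : 0 < 1 - β := by linarith
  have hIle : ‖mellin (Hilberdink.errN P ρ) (-(σ : ℂ))‖ ≤ C / (1 - β) :=
    hI.trans (div_le_div_of_nonneg_left hC h1β (by linarith))
  have hσ1 : 0 < σ - 1 := by linarith
  have t1 : ‖(ρ : ℂ) * (σ : ℂ) / ((σ : ℂ) - 1)‖ = ρ * σ / (σ - 1) := by
    rw [norm_div, norm_mul, Complex.norm_real, Complex.norm_real, ← Complex.ofReal_one,
      ← Complex.ofReal_sub, Complex.norm_real, Real.norm_of_nonneg hρ,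
      Real.norm_of_nonneg (by linarith), Real.norm_of_nonneg hσ1.le]
  have t2 : ‖(σ : ℂ) * mellin (Hilberdink.errN P ρ) (-(σ : ℂ))‖ ≤ 2 * (C / (1 - β)) := by
    rw [norm_mul, Complex.norm_real, Real.norm_of_nonneg (by linarith)]
    exact mul_le_mul h2 hIle (norm_nonneg _) (by norm_num)
  have hq : 0 ≤ C / (1 - β) := div_nonneg hC h1β.le
  calc ‖(ρ : ℂ) * (σ : ℂ) / ((σ : ℂ) - 1) + (σ : ℂ) * mellin (Hilberdink.errN P ρ) (-(σ : ℂ))‖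
      ≤ ‖(ρ : ℂ) * (σ : ℂ) / ((σ : ℂ) - 1)‖ + ‖(σ : ℂ) * mellin (Hilberdink.errN P ρ) (-(σ : ℂ))‖ :=
        norm_add_le _ _
    _ ≤ ρ * σ / (σ - 1) + 2 * (C / (1 - β)) := by rw [t1]; linarith
    _ ≤ (2 * ρ + 2 * (C / (1 - β))) / (σ - 1) := by
        rw [le_div_iff₀ hσ1, add_mul, div_mul_cancel₀ _ hσ1.ne']
        have e1 : ρ * σ ≤ ρ * 2 := mul_le_mul_of_nonneg_left h2 hρ
        have e2 : (σ - 1) * (C / (1 - β)) ≤ 1 * (C / (1 - β)) :=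
          mul_le_mul_of_nonneg_right (by linarith) hq
        linarith

/-- **Discharge of `MontgomeryVaughan2007_eq_8_49`: `ζ_P(1 + it) ≠ 0` (`t ≠ 0`)** for every analytic
continuation of `ζ_P` to `{Re s > β} ∖ {1}`, under `|N_P(x) − ρx| ≤ Cx^β`, `ρ > 0`, `β < 1`.
[cite: MontgomeryVaughan2007, §8.4, proof of Thm 8.10, eq. (8.49)] -/
theorem MontgomeryVaughan2007_eq_8_49_holds : MontgomeryVaughan2007_eq_8_49 := by
  intro P ρ β hρ hβ hN Z hZ t ht h0
  obtain ⟨C, hE⟩ := hN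
  have hK := Hilberdink.intCount_le_of_abs_le P hβ.le hE
  have hC : 0 ≤ C := Hilberdink.const_nonneg hE
  have hU : IsOpen {s : ℂ | β < s.re ∧ s ≠ 1} :=
    (isOpen_lt continuous_const continuous_re).inter isOpen_ne
  -- the points `1 + it`, `1 + 2it` lie in the domain
  have hs₁U : (1 : ℂ) + t * I ∈ {s : ℂ | β < s.re ∧ s ≠ 1} := by
    refine ⟨by simp; linarith, fun h ↦ ht ?_⟩
    have := congrArg Complex.im h
    simpa using this
  have hs₂U : (1 : ℂ) + 2 * t * I ∈ {s : ℂ | β < s.re ∧ s ≠ 1} := by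
    refine ⟨by simp; linarith, fun h ↦ ht ?_⟩
    have := congrArg Complex.im h
    simp at this
    linarith
  -- (b) `Z(σ + it) = O(σ − 1)` from differentiability at `1 + it` and `Z(1+it) = 0`
  have hd₁ : DifferentiableAt ℂ Z (1 + t * I) := hZ.2.differentiableAt (hU.mem_nhds hs₁U)
  have hO := hd₁.isBigO_sub
  rw [h0] at hO
  simp only [sub_zero] at hO
  have hp : Tendsto (fun σ : ℝ ↦ (σ : ℂ) + t * I) (𝓝 1) (𝓝 (1 + t * I)) := by
    have hc : Continuous (fun σ : ℝ ↦ (σ : ℂ) + t * I) := by fun_prop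
    simpa using hc.tendsto 1
  obtain ⟨K₀, hK₀⟩ := (hO.comp_tendsto hp).bound
  set K : ℝ := max K₀ 1 with hKdef
  have hK1 : 1 ≤ K := le_max_right _ _
  have hb : ∀ᶠ σ : ℝ in 𝓝 1, ‖Z ((σ : ℂ) + t * I)‖ ≤ K * |σ - 1| := by
    filter_upwards [hK₀] with σ hσ
    have hn : ‖((σ : ℂ) + t * I) - (1 + t * I)‖ = |σ - 1| := by
      rw [show ((σ : ℂ) + t * I) - (1 + t * I) = ((σ - 1 : ℝ) : ℂ) by push_cast; ring,
        Complex.norm_real, Real.norm_eq_abs]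
    have hσ' : ‖Z ((σ : ℂ) + t * I)‖ ≤ K₀ * ‖((σ : ℂ) + t * I) - (1 + t * I)‖ := hσ
    rw [hn] at hσ'
    exact hσ'.trans (mul_le_mul_of_nonneg_right (le_max_left _ _) (abs_nonneg _))
  -- (c) `Z(σ + 2it)` is bounded near `σ = 1` (continuity at `1 + 2it`)
  have hc₂ : ContinuousAt Z (1 + 2 * t * I) :=
    (hZ.2.differentiableAt (hU.mem_nhds hs₂U)).continuousAt
  set M : ℝ := ‖Z (1 + 2 * t * I)‖ + 1 with hMdef
  have hM0 : 0 < M := by rw [hMdef]; positivity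
  have hq : Tendsto (fun σ : ℝ ↦ (σ : ℂ) + 2 * t * I) (𝓝 1) (𝓝 (1 + 2 * t * I)) := by
    have hc : Continuous (fun σ : ℝ ↦ (σ : ℂ) + 2 * t * I) := by fun_prop
    simpa using hc.tendsto 1
  have hc : ∀ᶠ σ : ℝ in 𝓝 1, ‖Z ((σ : ℂ) + 2 * t * I)‖ ≤ M := by
    have h1 : ∀ᶠ s in 𝓝 (1 + 2 * t * I), ‖Z s‖ < M :=
      hc₂.norm.eventually (Iio_mem_nhds (by rw [hMdef]; linarith))
    exact (hq.eventually h1).mono fun σ h ↦ h.le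
  -- (a) the pole on the real axis and (d) the product inequality, combined on `𝓝[>] 1`
  set C₀ : ℝ := 2 * ρ + 2 * (C / (1 - β)) with hC₀def
  have hC₀ : 0 ≤ C₀ := by
    rw [hC₀def]
    have : 0 ≤ C / (1 - β) := div_nonneg hC (by linarith)
    linarith
  have hev : ∀ᶠ σ : ℝ in 𝓝[>] 1, (1 : ℝ) ≤ C₀ ^ 3 * K ^ 4 * M * (σ - 1) := by
    have hI12 : ∀ᶠ σ : ℝ in 𝓝[>] 1, σ ∈ Ioo (1 : ℝ) 2 := Ioo_mem_nhdsGT (by norm_num)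
    filter_upwards [hb.filter_mono nhdsWithin_le_nhds, hc.filter_mono nhdsWithin_le_nhds, hI12]
      with σ hbσ hcσ hσ
    obtain ⟨h1σ, h2σ⟩ := hσ
    have hσ1 : 0 < σ - 1 := by linarith
    have hre1 : 1 < ((σ : ℂ) + t * I).re := by simp; exact h1σ
    have hre2 : 1 < ((σ : ℂ) + 2 * t * I).re := by simp; exact h1σ
    rw [hZ.1 _ hre1, abs_of_pos hσ1] at hbσ
    rw [hZ.1 _ hre2] at hcσ
    have hd := one_le_norm_zeta_three_four_one P h1σ (Hilberdink.summable_prime_rpow P hK h1σ) t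
    have hA := norm_zeta_real_le hρ.le hβ hE h1σ h2σ.le
    have e1 : ‖P.zeta σ‖ ^ 3 ≤ (C₀ / (σ - 1)) ^ 3 := pow_le_pow_left₀ (norm_nonneg _) hA 3
    have e2 : ‖P.zeta (σ + t * I)‖ ^ 4 ≤ (K * (σ - 1)) ^ 4 := pow_le_pow_left₀ (norm_nonneg _) hbσ 4
    have hnn1 : 0 ≤ (C₀ / (σ - 1)) ^ 3 := pow_nonneg (div_nonneg hC₀ hσ1.le) 3
    have hnn2 : 0 ≤ (C₀ / (σ - 1)) ^ 3 * (K * (σ - 1)) ^ 4 :=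
      mul_nonneg hnn1 (pow_nonneg (mul_nonneg (by linarith) hσ1.le) 4)
    calc (1 : ℝ) ≤ ‖P.zeta σ‖ ^ 3 * ‖P.zeta (σ + t * I)‖ ^ 4 * ‖P.zeta (σ + 2 * t * I)‖ := hd
      _ ≤ (C₀ / (σ - 1)) ^ 3 * (K * (σ - 1)) ^ 4 * M :=
          mul_le_mul (mul_le_mul e1 e2 (by positivity) hnn1) hcσ (norm_nonneg _) hnn2
      _ = C₀ ^ 3 * K ^ 4 * M * (σ - 1) := by
          field_simp
  have hev2 : ∀ᶠ σ : ℝ in 𝓝[>] 1, C₀ ^ 3 * K ^ 4 * M * (σ - 1) < 1 := by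
    have hcont : Tendsto (fun σ : ℝ ↦ C₀ ^ 3 * K ^ 4 * M * (σ - 1)) (𝓝 1)
        (𝓝 (C₀ ^ 3 * K ^ 4 * M * (1 - 1))) :=
      ((continuous_const.mul (continuous_id.sub continuous_const)).tendsto 1)
    rw [sub_self, mul_zero] at hcont
    exact (hcont.eventually (Iio_mem_nhds one_pos)).filter_mono nhdsWithin_le_nhds
  obtain ⟨σ, h1, h2⟩ := (hev.and hev2).exists
  linarith

end Literature.NumberTheory.BeurlingPrimes

end
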